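import Summits.CriticalPhenomena.SAWScalingLimit.Theses.SAWPtolemyBoundary
import Literature.Probability.RandomPlanarGeometry.ConformalRestrictionProofs

/-!
# Line `birth` — registered skeleton for the crux `LSWRestrictionFact83` (stmt-CriticalPhenomena-15266)

Crux (FIXED; rank 9 of `route-CriticalPhenomena-SAWPtolemyBoundary`, sub-problem `SAWScalingLimit`;
verbatim the shared item stmt-CriticalPhenomena-3017): **[LSW03] p. 5 result 2 in hypothesis-free form** —
every chordal family `P` on Dobrushin domains which is chordal (`IsChordal`), conformally covariant
(`IsConformallyCovariant`), has the two-sided restriction property over ALL subdomains with the same marked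
points (`IsRestriction`) and is carried by simple curves meeting `∂D` only at the two marks, is the chordal
SLE_{8/3} law in every domain: `∀ D, IsSLELaw (8/3) D (P D)`.

## The cut — existence / uniqueness (the architecture of [LSW03] p. 5 result 2)

Lawler–Schramm–Werner prove result 2 as "uniqueness + identification of the survivor":

* S1 `stub_unique` (the HARD half; [LSW03] Prop. 3.3 with Lemma 3.2, Thm. 7.3, Cor. 8.6 and §8):
  **at most one restriction family is carried by simple curves** — two chordal, conformally covariant
  families with restriction over HULL subdomains (`IsHullRestriction`, the paper's `A ∈ 𝒬*`; weaker than the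
  crux's `IsRestriction`) carried by simple boundary-avoiding curves agree in every Dobrushin domain.
  Content: pulled back to `(ℍ; 0, ∞)` each `P D` is a dilation-invariant `𝒜₁`-covariant law, hence `P_α` for one
  `α` (Prop. 3.3); simplicity forces `α = 5/8` (Thm. 7.3: `α > 5/8` charges sets with interior; Cor. 8.6: no
  `P_α` below `5/8`); a law on simple curve classes with fixed endpoints is determined by the law of the trace.
* S2 `stub_sleFamily` (the existence half; [LSW03] Thm. 6.1 with Rohde–Schramm Thm. 5.1/6.1):
  **the chordal SLE_{8/3} laws form such a family** — there is a chordal family `Q`, chordal, conformally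
  covariant, with hull restriction, carried by simple boundary-avoiding curves, all of whose laws are chordal
  SLE_{8/3} laws. Content: the restriction martingale `h_t'(W_t)^{5/8} …` of Prop. 5.2/5.3 (Thm. 6.1),
  existence and uniqueness-in-law of the SLE_{8/3} curve in a Jordan domain, simplicity of the trace at
  `κ ≤ 4`, Carathéodory.

`LSWRestrictionFact83_of` (kernel-checked, no `sorry` of its own): given `P` as in the crux and a domain `D`,
`P` has hull restriction a fortiori (`ChordalFamily.IsRestriction.isHullRestriction`), so by S1 it agrees in
`D` with the family `Q` of S2, whose law in `D` is an SLE_{8/3} law.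

## STATUS NOTE for the lead / tenure planner (dedup finding, recorded honestly)

This crux is NOT open mathematics in the tree: it is verbatim stmt-CriticalPhenomena-3017, CLOSED/PROVED by
`Summit.CriticalPhenomena.SAWScalingLimit.Theorems.LSWSimpleRestrictionIsSLE_proof`
(`Theorems/SAWPoissonBanksLSWSimpleRestrictionIsSLE.lean`), and it is discharged in one line by the Literature
theorem `Literature.Probability.RandomPlanarGeometry.LawlerSchrammWerner2003_holds`
(`ConformalRestrictionHolds.lean`; candidate proof `S3.lean` attached to the item by refuter rreview-0816T14-0-0).
Accordingly BOTH stubs of this line are dischargeable from the library today: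
`stub_unique` is `LawlerSchrammWerner2003_unique_holds` (`ConformalRestrictionHolds.lean`) verbatim, and
`stub_sleFamily` follows from `exists_isSLECurve_of_ne_eight` (`SLEExistenceNeEightHolds.lean`),
`ChordalFamily.spec_of_isSLELaw_eightThirds` (`ConformalRestrictionLocal.lean`),
`IsSLELaw.hullRestriction_eightThirds_holds` (`HullRestrictionSLEHolds.lean`) and
`ae_isSimpleTrace_sleTrace_of_le_four_holds` (`CritPercSLESimplePathHolds.lean`). None of these files is
imported here (the skeleton states the line; it does not smuggle the proof). Recommended route action: land
the one-line proof of the item (prover), or drop the item and invoke `LawlerSchrammWerner2003_holds` inside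
`closes` (tenure planner) — see the registrar's NOTES.

## Disproof / negatives used
* `Cruxes/LSWRestrictionFact83/Disproof.lean`: none exists (`ledger crux ls stmt-CriticalPhenomena-15266`:
  "no workfiles yet", 2026-08-17) — no `_false_without_` obstruction to honour, no landed
  `Theorems/LSWRestrictionFact83/Negative/*`.
* `ledger negatives --problem CriticalPhenomena` (11 entries, 2026-08-17): none concerns restriction measures,
  conformal restriction or the identification of SLE_{8/3}; the only SAW-law entry (stmt-0772, all-`δ` tightness)
  is unrelated to this continuum statement.
* Vacuity / junk pass: S1 is not vacuous (S2 exhibits a family satisfying its eight hypotheses; the tree's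
  `tipFamily` satisfies restriction but is not carried by simple curves joining the marks); S2 is an existence
  statement with a non-trivial witness (the SLE_{8/3} laws), not closable by a junk family (the zero family
  fails `IsChordal`, Dirac families fail hull restriction + conformal covariance + `IsSLELaw`); the weaker
  `IsHullRestriction` in both stubs is deliberate — the SLE_{8/3} family is only known (and only claimed by
  [LSW03]) to satisfy restriction over hull subdomains, and the crux's stronger `IsRestriction` hypothesis on
  `P` implies it.
-/

noncomputable section

open scoped Topology MeasureTheory ENNReal NNReal
open Filter Set Function MeasureTheory
open Literature.Probability.RandomPlanarGeometry

namespace Summit.CriticalPhenomena.SAWScalingLimit.Cruxes.LSWRestrictionFact83.Birth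

/-! ### 1. The two statements of the line -/

/-- **S1 — uniqueness of the restriction family carried by simple curves** ([LSW03] p. 5 result 2, uniqueness
half; Prop. 3.3 with Lemma 3.2, Thm. 7.3, Cor. 8.6): two chordal families which are chordal, conformally
covariant, satisfy two-sided restriction over hull subdomains and are carried by simple curves meeting the
boundary only at the marked points coincide in every Dobrushin domain. (Literally the tree's named fact
`LawlerSchrammWerner2003_unique`.) -/
def UniqueSimpleRestrictionFamily : Prop :=
  ∀ P Q : ChordalFamily,
    P.IsChordal → P.IsConformallyCovariant → P.IsHullRestriction → P.IsCarriedBySimpleCurves →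
    Q.IsChordal → Q.IsConformallyCovariant → Q.IsHullRestriction → Q.IsCarriedBySimpleCurves →
    ∀ D : DobrushinDomain, P D = Q D

/-- **S2 — the SLE_{8/3} family qualifies** ([LSW03] Thm. 6.1 with Rohde–Schramm 2005 Thm. 5.1/6.1 and
Carathéodory): there is a chordal family which is chordal, conformally covariant, has restriction over hull
subdomains, is carried by simple boundary-avoiding curves, and all of whose laws are chordal SLE_{8/3} laws. -/
def SLEEightThirdsFamilyQualifies : Prop :=
  ∃ Q : ChordalFamily, Q.IsChordal ∧ Q.IsConformallyCovariant ∧ Q.IsHullRestriction ∧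
    Q.IsCarriedBySimpleCurves ∧ ∀ D : DobrushinDomain, IsSLELaw ((8 : ℝ≥0) / 3) D (Q D)

/-! ### 2. The registered stubs (the ONLY `sorry`s of this file) -/

/-- **Stub S1 (`stub_unique`, HARDEST; size XL from scratch, closed in the tree by
`LawlerSchrammWerner2003_unique_holds`)**: uniqueness of the restriction family carried by simple curves.
Why plausibly true: it is [LSW03] p. 5 result 2 (uniqueness), a published theorem, and a theorem of the tree.
Leans on: `ChordalFamily.IsHullRestriction`, `ChordalFamily.IsCarriedBySimpleCurves`
(`ConformalRestrictionProofs`). -/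
theorem stub_unique : UniqueSimpleRestrictionFamily := by
  sorry

/-- **Stub S2 (`stub_sleFamily`; size L from scratch, closed in the tree from `exists_isSLECurve_of_ne_eight`,
`ChordalFamily.spec_of_isSLELaw_eightThirds`, `IsSLELaw.hullRestriction_eightThirds_holds`,
`ae_isSimpleTrace_sleTrace_of_le_four_holds`)**: the family of chordal SLE_{8/3} laws is chordal, conformally
covariant, has hull restriction and is carried by simple boundary-avoiding curves. Why plausibly true:
[LSW03] Thm. 6.1 + [RS05]; theorems of the tree. Leans on: `IsSLELaw`, `IsSLECurve` (`SLE.lean`). -/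
theorem stub_sleFamily : SLEEightThirdsFamilyQualifies := by
  sorry

/-! ### Name-keyed aliases of the stub statements (hypotheses of the composition)

`Registered.stub_X : Prop` is the statement of `stub_X` under the registered stub's short name, so that the
skeleton audit (hypotheses admissible iff registered stubs BY NAME) accepts
`LSWRestrictionFact83_of : Registered.stub_unique → Registered.stub_sleFamily → LSWRestrictionFact83`
(device of `Cruxes/ChainLaw/Lines/birth.lean`, `Cruxes/BalanceChannel/Lines/birth.lean`). -/
namespace Registered

/-- Alias keyed by the registered stub name. -/
abbrev stub_unique : Prop := UniqueSimpleRestrictionFamily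
/-- Alias keyed by the registered stub name. -/
abbrev stub_sleFamily : Prop := SLEEightThirdsFamilyQualifies

end Registered

/-! ### 3. The sorry-free part: the composition -/

/-- **The composition (kernel-checked, no `sorry`)**: the two stubs imply the crux `LSWRestrictionFact83`
BY NAME. A family `P` as in the crux has restriction over hull subdomains a fortiori, so by S1 it agrees in
every domain with the SLE_{8/3} family of S2. -/
theorem LSWRestrictionFact83_of (h1 : Registered.stub_unique) (h2 : Registered.stub_sleFamily) :
    Summit.CriticalPhenomena.SAWScalingLimit.Theses.SAWPtolemyBoundary.LSWRestrictionFact83 := by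
  intro P hP hcov hres hsimple D
  obtain ⟨Q, hQc, hQcov, hQres, hQs, hQsle⟩ := h2
  have hPres : P.IsHullRestriction := ChordalFamily.IsRestriction.isHullRestriction hres
  rw [h1 P Q hP hcov hPres hsimple hQc hQcov hQres hQs D]
  exact hQsle D

/-- Wiring check: the registered stubs feed `LSWRestrictionFact83_of` as stated. -/
example : Summit.CriticalPhenomena.SAWScalingLimit.Theses.SAWPtolemyBoundary.LSWRestrictionFact83 :=
  LSWRestrictionFact83_of stub_unique stub_sleFamily

end Summit.CriticalPhenomena.SAWScalingLimit.Cruxes.LSWRestrictionFact83.Birth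

end
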